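import Literature.Barriers.PneNP.Relativization
import Literature.Computability.QuantumComplexity.OracleSeparations
import Literature.Computability.Cryptography.ClassBQP
import Literature.Computability.Complexity.Oracle
import Literature.Computability.Complexity.ProbabilisticClasses
import Literature.Barriers.PneNP.RelativizationSparseScope
import Literature.Computability.Complexity.CircuitClassesProofs
import Literature.Computability.QuantumComplexity.FortnowRogersBrain
import Literature.Computability.QuantumComplexity.OracleSeparationsProofs
import Literature.Computability.Cryptography.ClassBQPRelProofs
import HarnessLib

/-!
# Barrier catalogue `QuantumAdvantage`: relativization (Bernstein–Vazirani 1997, §8; Baker–Gill–Solovay)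

D-0021 barrier entry for the summit `QuantumAdvantage`
(`Summits/QuantumAdvantage/QuantumAdvantage/Statement.lean`:
`QuantumAdvantage := Literature.QuantumAdvantage.BQPNotSubsetBPP := ∃ L, L ∈ BQP ∧ L ∉ BPP`).

**The printed results.** Bernstein–Vazirani, *Quantum complexity theory*, SIAM J. Comput. 26
(1997) 1411–1473: Thm. 8.3 `BPP ⊆ BQP`, Thm. 8.4 `BQP ⊆ PSPACE`, Thm. 8.6 `BQP ⊆ P^{#P}`
(p. 1451–1452); Thm. 8.10 (an oracle QTM accepting `R_O` in polynomial time for every legal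
oracle `O`) with Cor. 8.14 ("for any `T(n)` which is `n^{o(log n)}` relative to a random legal
oracle `O`, with probability 1, `R_O` is not contained in `BPTime(T(n))`", p. 1462), whence an
oracle `B` with `BQP^B ⊄ BPP^B`; and §1, p. 1414: "The class BQP … satisfies
`BPP ⊆ BQP ⊆ P^{#P}`. This rules out the possibility of giving a mathematical proof that quantum
Turing machines are more powerful than classical probabilistic Turing machines (in the
unrelativized setting) unless there is a major breakthrough in complexity theory." The proofs of
Thms. 8.4/8.6 relativize, so for a `PSPACE`-complete oracle `A` one gets
`BQP^A ⊆ PSPACE^A = P^A ⊆ BPP^A` (folklore; the equality `P^A = PSPACE^A = NP^A` is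
Baker–Gill–Solovay's, Arora–Barak Thm. 3.7). Contrary oracles ⟹ neither `BQP ⊆ BPP` nor
`BQP ⊄ BPP` has a relativizing proof (the Baker–Gill–Solovay principle, Arora–Barak p. 74;
Impagliazzo–Kabanets–Kolokolova 2009, §1).

**What this file adds to the tree.** The two oracle facts are already vendored:
`Literature.Computability.QuantumComplexity.exists_oracle_BQPRel_subset_BPPRel` ([folklore], collapsing oracle) and
`Literature.Computability.QuantumComplexity.exists_oracle_BQPRel_not_subset_BPPRel` (**quantum-advantage.S13**,
separating oracle), and `Literature.Computability.QuantumComplexity.bqp_bpp_relativization_barrier` conjoins them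
(`Literature/Computability/QuantumComplexity/OracleSeparations.lean`). The technique class is the
tree's `Literature.Barriers.PneNP.Relativizes (Φ : Oracle → Prop) := ∀ A, Φ (Oracle.ofLanguage A)`
with the Baker–Gill–Solovay principle `not_relativizes_of_contrary`
(`Literature/Barriers/PneNP/Relativization.lean`). Here:

* `PresentsBQPRel C` — the bridge between the tree's oracle-indexed classical classes
  (`PRel`, `BPPRel : Oracle → Set (Language Bool)`, G01 transcript model) and the
  language-indexed quantum class `BQPRel : Language Bool → Set (Language Bool)` (Q2: XOR-query
  oracle gates): `C (Oracle.ofLanguage A) = BQPRel A` for every `A` — the same hypothesis `hC`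
  used for `BQP` in `Literature/Computability/Complexity/AlgebrizationBarriers.lean`
  (`not_isAlgebrizingInclusion_bqp_bpp`); a canonical presentation `bqpRelOf` (read the oracle's
  one-bit answers back as a language, `oracleLanguage`) is provided and proved to satisfy it, so
  the no-go theorems are not vacuous.
* `Relativization` — the barrier fact: contrary oracles for `BQP^· ⊆ BPP^·`, i.e. exactly the
  conjunction proved by `bqp_bpp_relativization_barrier` (this decl is the catalogue packaging of
  that theorem: `Relativization.iff_barrier`), PROVED from the two tree facts
  (`Relativization.of_facts`); nothing new is asserted.
* the no-go theorems, all proved: the summit's own shape `O ↦ ∃ L ∈ BQP^O, L ∉ BPP^O` does not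
  relativize (`Relativization.not_relativizes_summit_shape`), nor does its negation
  `O ↦ BQP^O ⊆ BPP^O` — the shape of route `Dequantize`'s thesis `BQP ⊆ BPP`
  (`Relativization.not_relativizes_collapse_shape`); both at once (`Relativization.summary`).
* the anchor `summit_shape_empty_iff`: at the empty oracle (`Oracle.empty = Oracle.ofLanguage 0`)
  the family is literally `∃ L ∈ BQP, L ∉ BPP`, through the tree facts `PRel_empty : P^∅ = P`
  (so `BPP^∅ = bp P^∅ = BPP` by `rfl` on `bp`) and `BQPRel_zero : BQP^0 = BQP`.

**Audit addendum (2026-08-16; D-0021 barrier audit, refuter).** The formal content above is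
CONFIRMED: every no-go is a theorem and the barrier fact is discharged (`Relativization_holds`,
`RelativizationProofs.lean`). The prose scope is NARROWED; the formal counterpart is the appended
section "Audit 2026-08-16: which oracles carry the barrier" with the named fact
`BQPRelativizationNarrow`, itself a theorem of this file (`BQPRelativizationNarrow_holds`,
`bqpRelativizationNarrow_iff`; the separating-oracle discharge `OracleSeparationsProofs.lean` is
imported here since the audit).
1. `technique_class`. "Relativizing" and "black-box" are different axes (Aaronson: "we need to
   distinguish carefully between relativizing and black-box algorithms … a nonrelativizing
   algorithm can still be black-box", §1.2, and the two barriers of §1.3), and diagonalization /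
   simulation arguments are blocked only insofar as they relativize (Arora–Barak §3.4 p. 75, as
   recorded for `PneNP`). For this summit "simulation" has a second meaning — CLASSICAL SIMULATION
   OF QUANTUM CIRCUITS, the negation-side routes: such a technique lies in the class iff it extends
   to circuits with black-box XOR-query gates; Feynman path sums and Schrödinger simulation do
   (they prove `BQP^O ⊆ P^{#P^O} ⊆ PSPACE^O`, Bernstein–Vazirani Thms. 8.4, 8.6) and are blocked,
   gate-set normal forms (stabilizer tableaux: Gottesman 1998, Thm. 1, "quantum computation is
   only more powerful than classical computation when it uses gates outside the Clifford group")
   do not extend and are untouched by this entry.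
2. Carrier classes (bounded relativization `CRelativizes 𝒞 Φ`, Hirahara–Lu–Ren, through
   `Literature.Barriers.PneNP.BoundedRelativization`). Summit side: a `𝒞`-bounded no-go exists iff
   `𝒞` contains a collapsing world (`not_cRelativizes_summit_shape_iff`), and then `BQP ⊆ BPP^𝒞`
   (`BQP_subset_BPPRelClass_of_not_cRelativizes`); a collapsing oracle in `P/poly` (sparse, tally)
   forces `BQP ⊆ P/poly` (`BQP_subset_PPoly_of_PPoly_collapse`, Meyer + Adleman, tree theorems), so
   thin-oracle-robust arguments FOR the summit are not blocked unless `BQP ⊆ P/poly`, and every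
   proof of `BQP ⊄ P/poly` is `P/poly`-oracle-robust for free (`ppoly_cRelativizes_summit_shape`).
   The collapsing worlds in hand are thick instead: Ko's self-encoding oracle (`BQP^A ⊆ P^A`, tree
   theorem `exists_oracle_BQPRel_subset_PRel`), any `PSPACE`-complete oracle (Fortnow–Rogers, proof
   of Thm. 4.2: "`H` can be any PSPACE-complete language … identifies P and PSPACE (and so
   P = BPP = BQP)"; Aaronson–Ingram–Kretschmer §1.2: "clearly there are oracles relative to which
   P = BQP—for example, a PSPACE-complete oracle"; not a tree fact for `BQPRel`), and the whole
   Fortnow–Rogers brain cone `{K ⊕ G : G with at most one string per length}` (tree theorem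
   `FRBrain.exists_brain`; `exists_brain_cone`). Negation side (`BQP ⊆ BPP`, route `Dequantize`): a
   `𝒞`-bounded no-go exists iff `𝒞` contains a separating world
   (`not_cRelativizes_collapse_shape_iff`); the separating worlds of the tree and of print
   (Bernstein–Vazirani, Simon, Raz–Tal) are DENSE; a tally separating world is implied by the
   summit itself (`not_cRelativizes_tally_collapse_shape_of_summit`), and no thin `G` separates over
   the brain (BBBV hybrid bound plus a heavy-query fixed-point loop, Fortnow–Rogers p. 7) — in
   contrast with Baker–Gill–Solovay, whose separating oracle for `P` versus `NP` IS sparse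
   (`Literature.Barriers.PneNP.bgs_ne_sparse`): nondeterminism finds isolated strings,
   bounded-error quantum queries do not (BBBV Cor. 3.4, Thm. 3.5).
3. The promise seam. `BQP` and `BPP` are promise classes in Hemachandra–Rubinstein's sense
   ("bounded-error probabilistic classes such as R", §3), for which Long–Selman's tally positive
   relativization (their Lemma 2.3) FAILS in relativized worlds (Thm. 2.1 (3): `P^C = R^C` and
   `P^{C ⊕ T''} ≠ R^{C ⊕ T''}`, `T''` tally). Accordingly the two thin-oracle questions that item 2
   leaves open close up exactly at the PROMISE versions (observations of this audit, prose only):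
   `PromiseBQP ⊆ PromiseP/poly` ⟹ some tally `T` has `BQP^T ⊆ P^T` (read the table, then evaluate
   the advice circuits on the oracle-free instance, which keeps its promise), and
   `PromiseBQP ⊆ PromiseBPP` ⟹ `BQP^S ⊆ BPP^S` for every sparse `S` (the brain loop with a
   `PromiseBPP` simulator in place of the brain), whereas the language-level versions
   (`BQP ⊆ P/poly ⟹ …`, `BQP ⊆ BPP ⟹ ∀ tally T, BQP^T ⊆ BPP^T`) are instances of the open promise
   lift (`Literature.Barriers.QuantumAdvantage.PromiseLiftRelativization`; Goldreich 2011, §6;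
   Aaronson–Arkhipov 2013, §10).
No literature contradicting the barrier fact was found (searched 2026-08-16: local index, arXiv,
Explorer corpora; OpenAlex and Semantic Scholar were rate-limited that day): every printed
"evasion" is a technique outside the class — "almost all such examples have originated from a
single source: namely, the use of algebraic techniques in interactive proof systems"
(`IP = PSPACE`, `MIP = NEXP`, `MIP* = RE`; Aaronson–Ingram–Kretschmer §1.2), themselves stopped
here by algebrization (`Literature.Barriers.QuantumAdvantage.Algebrization`).

## Sources (locators verified with `lit read` on the held copies unless marked)

* E. Bernstein, U. Vazirani, *Quantum complexity theory*, SIAM J. Comput. 26 (1997) 1411–1473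
  [BernsteinVazirani1997SICOMP] (held: `lit read paper:doi-10-1145-167088-167097`, SIAM
  pagination): §1 p. 1414 (quoted above); Thm. 8.3, 8.4 (p. 1451), Thm. 8.6 (p. 1452), §8.3
  p. 1455 (more general, non-Boolean oracle notions "have been used to obtain large separations
  between quantum and classical relativized complexity classes"), §8.4 p. 1455 (relevance of
  oracle results versus the non-relativizing PCP results; Arora–Impagliazzo–Vazirani), Thm. 8.10
  (p. 1459), Cor. 8.14 (p. 1462).
* S. Arora, B. Barak, *Computational Complexity: A Modern Approach*, CUP 2009 [AroraBarakCC2009]: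
  §3.4 and Thm. 3.7 (p. 74: Baker–Gill–Solovay, "whichever of `P = NP` or `P ≠ NP` is true; it
  cannot be a relativizing result"), §3.4.1 pp. 75–76 — as used and cited in
  `Literature/Barriers/PneNP/Relativization.lean`.
* R. Impagliazzo, V. Kabanets, A. Kolokolova, *An axiomatic approach to algebrization*, STOC 2009
  [ImpagliazzoKabanetsKolokolova2009], §1 (contrary oracles ⟹ no relativizing resolution).
* S. Aaronson, A. Wigderson, *Algebrization: a new barrier in complexity theory*, STOC 2008
  [AaronsonWigderson2008] (held 50-page full version, `paper:doi-10-1145-1374376-1374481`):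
  Thm. 5.11 (v) p. 28 (`A, Ã` with `BQP^A ⊄ BPP^Ã`), Thm. 5.2 p. 23 (`PSPACE^{Ã[poly]} = P^A`),
  §1 p. 7 table ("Proving `NP ⊆ BQP`, `BPP = BQP`, etc. will require non-algebrizing
  techniques"); tree facts `aaronsonWigderson2009_bqp_not_subset_bpp`,
  `aaronsonWigderson2009_bqp_subset_bpp_collapse` (`AlgebrizationBarriers.lean`).
* (audit addendum 2026-08-16, all held and read with `lit read`) L. Fortnow, J. Rogers,
  *Complexity limitations on quantum computation*, JCSS 59 (1999) [FortnowRogers1999JCSS]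
  (arXiv:cs/9811023 numbering): Thm. 4.2 with its proof and Thm. 4.3 (p. 7). C. H. Bennett,
  E. Bernstein, G. Brassard, U. Vazirani, *Strengths and weaknesses of quantum computing*, SIAM
  J. Comput. 26 (1997) [BennettBernsteinBrassardVazirani1997] (arXiv:quant-ph/9701001
  numbering): Thm. 3.3, Cor. 3.4, Thm. 3.5 (pp. 7–8). S. Aaronson, *Oracles are subtle but not
  malicious*, CCC 2006 [Aaronson2006] (arXiv:cs/0504048): §1.2–§1.3 (pp. 5–6). S. Aaronson,
  D. Ingram, W. Kretschmer, *The acrobatics of BQP*, CCC 2022 [AaronsonIngramKretschmer2022]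
  (arXiv:2111.10409): §1.2 (pp. 4–5). L. Hemachandra, R. Rubinstein, *Separating complexity
  classes with tally oracles*, TCS 92 (1992) 309–318 [HemachandraRubinstein1992]: §1 (p. 310),
  Thm. 2.1 (p. 312), Lemma 2.3 (p. 313), §3 (p. 316). D. Gottesman, *The Heisenberg representation
  of quantum computers* (1999) [Gottesman1998] (arXiv:quant-ph/9807006): Thm. 1 (p. 13).
  Through the imported entries: S. Hirahara, Z. Lu, H. Ren, *Bounded relativization*, CCC 2023
  [HiraharaLuRen2023], §1.1 and §1.4.2 (`PneNP/BoundedRelativization.lean`); U. Schöning 1995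
  [Schoning1995] §3–§4 and J. Kadin 1989 [Kadin1989] §1 (`PneNP/RelativizationSparse.lean`);
  T. Long, A. Selman 1986 [LongSelman1986] (`PneNP/RelativizationSparseTallyProofs.lean`);
  O. Goldreich 2011 [Goldreich2011] §6 and S. Aaronson, A. Arkhipov, ToC 9 (2013)
  [AaronsonArkhipovToC2013] §10 (`PromiseLiftRelativization.lean`).
-/

noncomputable section

namespace Literature.Barriers.QuantumAdvantage

open _root_.Computability Literature.Computability.Complexity Literature.Computability.Complexity.Classes Literature.Computability.Cryptography Literature.Computability.QuantumComplexity PneNP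

/-! ### The bridge: presenting `BQP^·` as an oracle-indexed class -/

/-- `PresentsBQPRel C`: the oracle-indexed class `C : Oracle → Set (Language Bool)` agrees with
the tree's language-indexed relativized `BQP` on language oracles,
`C (Oracle.ofLanguage A) = BQP^A` for all `A ⊆ {0,1}*`. This is the hypothesis `hC` under which
`Literature/Computability/Complexity/AlgebrizationBarriers.lean` states the `BQP` instances of
the algebrization predicates; `Relativizes` only ever evaluates at language oracles, so any two
presentations give the same relativized statements. [folklore] -/
def PresentsBQPRel (C : Oracle → Set (Language Bool)) : Prop :=
  ∀ A : Language Bool, C (Oracle.ofLanguage A) = BQPRel A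

/-- The language answered by an oracle: the queries whose answer is the one-symbol string
`encodeBool true`. For `Oracle.ofLanguage A` this is `A` (`oracleLanguage_ofLanguage`).
[cite: BakerGillSolovay1975, §1] -/
def oracleLanguage (O : Oracle) : Language Bool :=
  {q | O q = encodeBool true}

/-- Reading back the language of a language oracle. [folklore] -/
@[simp] theorem oracleLanguage_ofLanguage (A : Language Bool) :
    oracleLanguage (Oracle.ofLanguage A) = A := by
  refine Language.ext fun q => ?_
  show Oracle.ofLanguage A q = encodeBool true ↔ q ∈ A
  rw [Oracle.ofLanguage_apply]
  by_cases hq : q ∈ A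
  · have h : A.boolIndicator q = true := (Set.mem_iff_boolIndicator _ _).1 hq
    rw [h]
    exact ⟨fun _ => hq, fun _ => rfl⟩
  · have h : A.boolIndicator q = false := (Set.notMem_iff_boolIndicator _ _).1 hq
    rw [h]
    exact ⟨fun h' => by simp [encodeBool] at h', fun h' => (hq h').elim⟩

/-- The canonical presentation `O ↦ BQP^{oracleLanguage O}` of relativized `BQP` as an
oracle-indexed class. [folklore] -/
def bqpRelOf (O : Oracle) : Set (Language Bool) :=
  BQPRel (oracleLanguage O)

/-- The canonical presentation agrees with `BQPRel` on language oracles. [folklore] -/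
theorem presentsBQPRel_bqpRelOf : PresentsBQPRel bqpRelOf :=
  fun A => by simp [bqpRelOf]

/-- `PresentsBQPRel` is inhabited. [folklore] -/
theorem presentsBQPRel_nonempty : ∃ C, PresentsBQPRel C :=
  ⟨bqpRelOf, presentsBQPRel_bqpRelOf⟩

/-! ### The barrier fact -/

/-- **Relativization barrier for `BQP` versus `BPP`** (Bernstein–Vazirani 1997, §8 with
Baker–Gill–Solovay 1975: there are oracles `A`, `B` with `BQP^A ⊆ BPP^A` and `BQP^B ⊄ BPP^B`).
Stated over the tree's `BQPRel A` (uniform Clifford+T families with XOR-query gates to `A`) and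
`BPPRel (Oracle.ofLanguage A) = bp (P^A)`; PROVED below (`Relativization.of_facts`) from the tree
facts `exists_oracle_BQPRel_subset_BPPRel` ([folklore]) and
`exists_oracle_BQPRel_not_subset_BPPRel` (S13), and equivalent to the conclusion of the tree
theorem `bqp_bpp_relativization_barrier` (`Relativization.iff_barrier`).

BARRIER
technique_class: relativizing, oracle-independent, diagonalization, simulation, black-box
blocks: every relativizing proof of the summit `QuantumAdvantage` (`∃ L ∈ BQP, L ∉ BPP`, the `O = ∅` instance of `O ↦ ∃ L ∈ BQP^O, L ∉ BPP^O`, see `summit_shape_empty_iff`) AND every relativizing proof of its negation `BQP ⊆ BPP` (the `O = ∅` instance of `O ↦ BQP^O ⊆ BPP^O`; unrelativized this is route `Dequantize`'s thesis `DeqThesis : BQP ⊆ BPP`); proved instances: `Relativization.not_relativizes_summit_shape`, `Relativization.not_relativizes_collapse_shape`, `Relativization.summary`.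
because: a relativizing argument proves its conclusion relative to every language oracle (Arora–Barak §3.4 p. 74; formally `Relativizes`) [cite: AroraBarakCC2009, §3.4 and Thm. 3.7, p. 74]; but the proofs of `BQP ⊆ P^{#P} ⊆ PSPACE` relativize [cite: BernsteinVazirani1997SICOMP, Thm. 8.4 and Thm. 8.6, pp. 1451–1452], so for a `PSPACE`-complete `A`, `BQP^A ⊆ PSPACE^A = P^A ⊆ BPP^A` (tree fact `exists_oracle_BQPRel_subset_BPPRel`, [folklore]; `P^A = PSPACE^A` is Baker–Gill–Solovay's collapsing oracle [cite: AroraBarakCC2009, Thm. 3.7]), while recursive Fourier sampling gives `B` with `R_B ∈ BQP^B` and `R_B ∉ BPTime(n^{o(log n)})^B ⊇ BPP^B` [cite: BernsteinVazirani1997SICOMP, Thm. 8.10 and Cor. 8.14] (tree fact `exists_oracle_BQPRel_not_subset_BPPRel`, also Simon 1997); contrary oracles kill both `Φ` and `¬ Φ` as relativizing statements (`not_relativizes_of_contrary`) [cite: ImpagliazzoKabanetsKolokolova2009, §1].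
evasions_known: non-relativizing techniques exist (arithmetization: `IP = PSPACE` despite a contrary oracle; PCP) [cite: AroraBarakCC2009, §3.4 p. 75 and §8.3] [cite: BernsteinVazirani1997SICOMP, §8.4 p. 1455], but for `BQP` versus `BPP` algebrizing techniques are also insufficient in BOTH directions: `A, Ã` with `BQP^A ⊄ BPP^Ã` and, via `PSPACE^{Ã[poly]} = P^A`, `A, Ã` with `BQP^Ã ⊆ BPP^A` [cite: AaronsonWigderson2008, Thm. 5.11 (v) p. 28, Thm. 5.2 p. 23 and §1 p. 7] (tree facts `aaronsonWigderson2009_bqp_not_subset_bpp`, `aaronsonWigderson2009_bqp_subset_bpp_collapse`); conditional separations are untouched — the barrier concerns unconditional proofs only, and Bernstein–Vazirani read their oracle results as evidence, not proof, because of the black-box nature of programs under `P ≠ NP` plus one-way functions [cite: BernsteinVazirani1997SICOMP, §8.4 p. 1455]; local checkability / the theory `RCT` makes "relativizing" precise and shows what a non-relativizing axiom must add [cite: ImpagliazzoKabanetsKolokolova2009, §1] [cite: AroraBarakCC2009, §3.4.1 pp. 75–76].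
scope_caveats: (a) "relativizing proof" is informal; the formal content is exactly `¬ Relativizes Φ` for the two listed shapes, derived from the two oracle-existence facts [cite: AroraBarakCC2009, §3.4.1 pp. 75–76]; (b) the oracle-access model is fixed: `BQPRel A` = poly-time uniform Clifford+T families with XOR-query gates to the language `A`, `BPPRel` = `bp` of G01's transcript-model `P^O` at `O = Oracle.ofLanguage A`; only language oracles are quantified, and Bernstein–Vazirani note that more general (non-Boolean unitary) oracle notions yield larger quantum/classical separations [cite: BernsteinVazirani1997SICOMP, §8.3 p. 1455]; (c) the collapsing fact is [folklore] in the tree — Bernstein–Vazirani print Thms. 8.4/8.6 unrelativized and `P^A = PSPACE^A` is Baker–Gill–Solovay's — and the separating fact is typed as `BQP^B ⊄ BPP^B`, weaker than the printed `R_O ∉ BPTime(n^{o(log n)})` for a random legal oracle with probability 1 [cite: BernsteinVazirani1997SICOMP, Cor. 8.14]; (d) equality shapes `BQP^O = BPP^O` are not derived because the relativized `BPP^O ⊆ BQP^O` (Thm. 8.3 relativized) is not a tree fact; (e) the promise-problem, sampling, `P/poly` and average-case strengthenings of the summit (routes `PromiseLift`, `CircuitLB`, `AvgCase`) are NOT covered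 by any decl here — only the language classes `BQP^O`, `BPP^O`; (f) (audit 2026-08-16; formal counterpart: the appended section and `BQPRelativizationNarrow`) the `technique_class` keywords `diagonalization, simulation, black-box` are covered ONLY insofar as the argument relativizes over ALL language oracles in the full-access models [cite: AroraBarakCC2009, §3.4 p. 75] — "relativizing" and "black-box" are different axes [cite: Aaronson2006, §1.2–§1.3 (pp. 5–6) (arXiv numbering)], and classical simulations of explicit gate sets are in the class iff they extend to black-box XOR-query gates (path sums do [cite: BernsteinVazirani1997SICOMP, Thm. 8.4 and Thm. 8.6], stabilizer normal forms do not [cite: Gottesman1998, Thm. 1 (p. 13) (arXiv numbering)]); (g) the no-go against the summit is carried only by oracles OUTSIDE every class `𝒞` with `BQP ⊄ BPP^𝒞` (`BQP_subset_BPPRelClass_of_not_cRelativizes`), in particular outside `P/poly` unless `BQP ⊆ P/poly` (`BQP_subset_PPoly_of_PPoly_collapse`, `ppoly_cRelativizes_summit_shape` with its sparse / tally forms), while the collapsing worlds in hand form a whole cone `{K ⊕ G : G thin}` (`exists_brain_cone`) [cite: FortnowRogers1999JCSS, Thm. 4.2 (proof, p. 7) (arXiv numbering)]; the no-go against `BQP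 ⊆ BPP` is carried only by the dense separating oracles in hand — a tally one is the summit itself (`not_cRelativizes_tally_collapse_shape_of_summit`), the brain cone has none, and the promise-class seam of both thin-oracle questions is prose in `BQPRelativizationNarrow` [cite: HemachandraRubinstein1992, Thm. 2.1 (p. 312)].
status: established (theorem; proved here from the tree facts) [cite: BernsteinVazirani1997SICOMP, Thm. 8.10, Cor. 8.14, Thm. 8.4] [cite: AroraBarakCC2009, Thm. 3.7] -/
def Relativization : Prop :=
  ∃ A B : Language Bool,
    BQPRel A ⊆ BPPRel (Oracle.ofLanguage A) ∧ ¬ BQPRel B ⊆ BPPRel (Oracle.ofLanguage B)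

/-- `Relativization` assembled from the two oracle facts of `OracleSeparations.lean`.
[cite: BernsteinVazirani1997SICOMP, Thm. 8.10 and Cor. 8.14] -/
theorem Relativization.of_facts (h₁ : exists_oracle_BQPRel_subset_BPPRel)
    (h₂ : exists_oracle_BQPRel_not_subset_BPPRel) : Relativization := by
  obtain ⟨A, hA⟩ := h₁
  obtain ⟨B, hB⟩ := h₂
  exact ⟨A, B, hA, hB⟩

/-- `Relativization` is (up to currying) the conclusion of the tree theorem
`Literature.Computability.QuantumComplexity.bqp_bpp_relativization_barrier`; this decl is its catalogue packaging.
[folklore] -/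
theorem Relativization.iff_barrier :
    Relativization ↔
      (∃ A : Language Bool, BQPRel A ⊆ BPPRel (Oracle.ofLanguage A)) ∧
        ∃ B : Language Bool, ¬ BQPRel B ⊆ BPPRel (Oracle.ofLanguage B) := by
  constructor
  · rintro ⟨A, B, hA, hB⟩
    exact ⟨⟨A, hA⟩, ⟨B, hB⟩⟩
  · rintro ⟨⟨A, hA⟩, ⟨B, hB⟩⟩
    exact ⟨A, B, hA, hB⟩

/-- The tree theorem `bqp_bpp_relativization_barrier` yields `Relativization`. [folklore] -/
theorem Relativization.of_barrier (h₁ : exists_oracle_BQPRel_subset_BPPRel)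
    (h₂ : exists_oracle_BQPRel_not_subset_BPPRel) : Relativization :=
  Relativization.iff_barrier.2 (bqp_bpp_relativization_barrier h₁ h₂)

/-! ### The no-go theorems (proved) -/

/-- The summit's shape does not relativize: `O ↦ ∃ L ∈ BQP^O, L ∉ BPP^O` fails at the collapsing
oracle `A` (`BQP^A ⊆ BPP^A`), for every presentation `C` of `BQP^·`.
[cite: AroraBarakCC2009, Thm. 3.7 and p. 74 ("cannot be a relativizing result")] -/
theorem Relativization.not_relativizes_summit_shape (h : Relativization)
    {C : Oracle → Set (Language Bool)} (hC : PresentsBQPRel C) :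
    ¬ Relativizes fun O => ∃ L ∈ C O, L ∉ BPPRel O := by
  obtain ⟨A, B, hA, -⟩ := h
  intro hrel
  obtain ⟨L, hL, hLB⟩ := hrel A
  rw [hC A] at hL
  exact hLB (hA hL)

/-- The negation's shape does not relativize: `O ↦ BQP^O ⊆ BPP^O` fails at the separating oracle
`B` (`BQP^B ⊄ BPP^B`), for every presentation `C` of `BQP^·`.
[cite: AroraBarakCC2009, Thm. 3.7 and p. 74] [cite: BernsteinVazirani1997SICOMP, Cor. 8.14] -/
theorem Relativization.not_relativizes_collapse_shape (h : Relativization)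
    {C : Oracle → Set (Language Bool)} (hC : PresentsBQPRel C) :
    ¬ Relativizes fun O => C O ⊆ BPPRel O := by
  obtain ⟨A, B, -, hB⟩ := h
  intro hrel
  have hB' : C (Oracle.ofLanguage B) ⊆ BPPRel (Oracle.ofLanguage B) := hrel B
  rw [hC B] at hB'
  exact hB hB'

/-- The Baker–Gill–Solovay principle applied verbatim: with `Φ O := C O ⊆ BPP^O`, the contrary
oracles show that neither `Φ` nor `¬ Φ` relativizes (`not_relativizes_of_contrary`).
[cite: ImpagliazzoKabanetsKolokolova2009, §1] [cite: AroraBarakCC2009, Thm. 3.7] -/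
theorem Relativization.not_relativizes_either (h : Relativization)
    {C : Oracle → Set (Language Bool)} (hC : PresentsBQPRel C) :
    (¬ Relativizes fun O => C O ⊆ BPPRel O) ∧ ¬ Relativizes fun O => ¬ C O ⊆ BPPRel O := by
  obtain ⟨A, B, hA, hB⟩ := h
  refine not_relativizes_of_contrary (Φ := fun O => C O ⊆ BPPRel O) A B ?_ ?_
  · show C (Oracle.ofLanguage A) ⊆ BPPRel (Oracle.ofLanguage A)
    rw [hC A]; exact hA
  · show ¬ C (Oracle.ofLanguage B) ⊆ BPPRel (Oracle.ofLanguage B)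
    rw [hC B]; exact hB

/-- Both directions at once, in the summit's shape and its negation's shape.
[cite: AroraBarakCC2009, Thm. 3.7 and p. 74] -/
theorem Relativization.summary (h : Relativization)
    {C : Oracle → Set (Language Bool)} (hC : PresentsBQPRel C) :
    (¬ Relativizes fun O => ∃ L ∈ C O, L ∉ BPPRel O) ∧
      ¬ Relativizes fun O => C O ⊆ BPPRel O :=
  ⟨h.not_relativizes_summit_shape hC, h.not_relativizes_collapse_shape hC⟩

/-- The summary for the canonical presentation `bqpRelOf` (no hypothesis left besides the
barrier fact). [cite: AroraBarakCC2009, Thm. 3.7 and p. 74] -/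
theorem Relativization.summary_bqpRelOf (h : Relativization) :
    (¬ Relativizes fun O => ∃ L ∈ bqpRelOf O, L ∉ BPPRel O) ∧
      ¬ Relativizes fun O => bqpRelOf O ⊆ BPPRel O :=
  h.summary presentsBQPRel_bqpRelOf

/-! ### Anchor: the empty-oracle instance is the summit statement -/

/-- `BPP^∅ = BPP`, from the tree fact `PRel_empty : P^∅ = P` (`BPPRel O = bp (P^O)`,
`BPP = bp P`). [cite: BakerGillSolovay1975, §1 (P^∅ = P)] -/
theorem BPPRel_empty (hE : PRel_empty) : BPPRel Oracle.empty = BPP := by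
  change bp (PRel Oracle.empty) = bp P
  rw [show PRel Oracle.empty = P from hE]

/-- `bqpRelOf ∅ = BQP`, from the tree fact `BQPRel_zero : BQP^0 = BQP`
(`Oracle.empty = Oracle.ofLanguage 0`). [cite: BernsteinVazirani1997SICOMP, §8.3 (oracle QTMs)] -/
theorem bqpRelOf_empty (hZ : BQPRel_zero) : bqpRelOf Oracle.empty = BQP := by
  change BQPRel (oracleLanguage (Oracle.ofLanguage 0)) = BQP
  rw [oracleLanguage_ofLanguage]
  exact hZ

/-- At the empty oracle the family `O ↦ ∃ L ∈ BQP^O, L ∉ BPP^O` (canonical presentation) is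
the summit's definiens `∃ L, L ∈ BQP ∧ L ∉ BPP`
(`Literature.QuantumAdvantage.BQPNotSubsetBPP`, `Summits/QuantumAdvantage/QuantumAdvantage/Statement.lean`,
which Literature cannot import; the two `Prop`s agree syntactically). Since
`Oracle.empty = Oracle.ofLanguage 0`, `Relativizes.empty` specialises any relativizing statement
to this instance. [cite: BernsteinVazirani1997SICOMP, §1 p. 1414] -/
theorem summit_shape_empty_iff (hE : PRel_empty) (hZ : BQPRel_zero) :
    (∃ L ∈ bqpRelOf Oracle.empty, L ∉ BPPRel Oracle.empty) ↔
      ∃ L : Language Bool, L ∈ BQP ∧ L ∉ BPP := by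
  rw [BPPRel_empty hE, bqpRelOf_empty hZ]

/-- Likewise the negation's family at the empty oracle is `BQP ⊆ BPP` (route `Dequantize`'s
thesis, unrelativized). [cite: BernsteinVazirani1997SICOMP, §1 p. 1414] -/
theorem collapse_shape_empty_iff (hE : PRel_empty) (hZ : BQPRel_zero) :
    bqpRelOf Oracle.empty ⊆ BPPRel Oracle.empty ↔ BQP ⊆ BPP := by
  rw [BPPRel_empty hE, bqpRelOf_empty hZ]

/-! ### Audit 2026-08-16 (D-0021 barrier audit): which oracles carry the barrier

Bounded relativization (`CRelativizes 𝒞 Φ`, `Literature.Barriers.PneNP.BoundedRelativization`)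
applied to the two shapes of this entry. Summit side: the no-go is carried exactly by the classes
containing a COLLAPSING world `BQP^A ⊆ BPP^A`; such a world puts `BQP` inside `BPP^A`, so inside
`BPP^𝒞`, and inside `P/poly` when `A ∈ P/poly` — thin (tally / sparse / `P/poly`) oracles carry
no barrier against the summit unless `BQP ⊆ P/poly`. Negation side: the no-go is carried exactly
by the classes containing a SEPARATING world; the tree's and the printed separating worlds are
dense, the whole Fortnow–Rogers brain cone `{K ⊕ G : G thin}` collapses, and a tally separating
world is the summit itself. -/

/-- **Exact reach of the barrier against the summit's shape.** Over a class `𝒞` of oracles,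
`O ↦ ∃ L ∈ BQP^O, L ∉ BPP^O` fails to be `𝒞`-relativizing iff `𝒞` contains a COLLAPSING world
`BQP^A ⊆ BPP^A` (for `𝒞 = univ`: `Relativization.not_relativizes_summit_shape`), for every
presentation `C` of `BQP^·`. [cite: HiraharaLuRen2023, §1.1 (p. 3) and §1.4.2 (p. 11)] -/
theorem not_cRelativizes_summit_shape_iff (𝒞 : Set (Language Bool))
    {C : Oracle → Set (Language Bool)} (hC : PresentsBQPRel C) :
    (¬ CRelativizes 𝒞 fun O => ∃ L ∈ C O, L ∉ BPPRel O) ↔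
      ∃ A ∈ 𝒞, BQPRel A ⊆ BPPRel (Oracle.ofLanguage A) := by
  rw [not_cRelativizes_iff]
  refine exists_congr fun A => and_congr_right fun _ => ?_
  rw [hC A]
  simp only [not_exists, not_and, not_not]
  rfl

/-- **Exact reach of the barrier against the negation's shape.** Over a class `𝒞`,
`O ↦ BQP^O ⊆ BPP^O` fails to be `𝒞`-relativizing iff `𝒞` contains a SEPARATING world
`BQP^B ⊄ BPP^B` (for `𝒞 = univ`: `Relativization.not_relativizes_collapse_shape`).
[cite: HiraharaLuRen2023, §1.1 (p. 3) and §1.4.2 (p. 11)] -/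
theorem not_cRelativizes_collapse_shape_iff (𝒞 : Set (Language Bool))
    {C : Oracle → Set (Language Bool)} (hC : PresentsBQPRel C) :
    (¬ CRelativizes 𝒞 fun O => C O ⊆ BPPRel O) ↔
      ∃ B ∈ 𝒞, ¬ BQPRel B ⊆ BPPRel (Oracle.ofLanguage B) := by
  rw [not_cRelativizes_iff]
  refine exists_congr fun B => and_congr_right fun _ => ?_
  rw [hC B]

/-- Degenerate small end: over the single world `∅` the summit's shape (canonical presentation)
is the summit statement `∃ L ∈ BQP, L ∉ BPP` itself (tree facts `PRel_empty`, `BQPRel_zero`).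
[cite: HiraharaLuRen2023, §1.1 (p. 3)] -/
theorem cRelativizes_singleton_zero_summit_shape_iff (hE : PRel_empty) (hZ : BQPRel_zero) :
    (CRelativizes {(0 : Language Bool)} fun O => ∃ L ∈ bqpRelOf O, L ∉ BPPRel O) ↔
      ∃ L : Language Bool, L ∈ BQP ∧ L ∉ BPP := by
  rw [cRelativizes_singleton_zero_iff, summit_shape_empty_iff hE hZ]

/-! #### A collapsing world swallows `BQP` -/

/-- A collapsing world `A` puts `BQP` inside `BPP^A`: `BQP ⊆ BQP^A ⊆ BPP^A` (tree theorem
`BQP_subset_BQPRel`: an oracle-free family is an oracle family). [cite: FortnowRogers1999JCSS, proof of Thm. 4.2 (p. 7: "identifies P and PSPACE (and so P = BPP = BQP)") (arXiv numbering)] -/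
theorem BQP_subset_BPPRel_of_collapse {A : Language Bool}
    (h : BQPRel A ⊆ BPPRel (Oracle.ofLanguage A)) : BQP ⊆ BPPRel (Oracle.ofLanguage A) :=
  (BQP_subset_BQPRel A).trans h

/-- `BPP^A ⊆ BPP^𝒞` for `A ∈ 𝒞` (`BPPRelClass 𝒞 = ⋃_{A ∈ 𝒞} BPP^A`). [cite: AroraBarakCC2009, §3.4 (oracle classes)] -/
theorem BPPRel_subset_BPPRelClass_of_mem {𝒞 : Set (Language Bool)} {A : Language Bool}
    (hA : A ∈ 𝒞) : BPPRel (Oracle.ofLanguage A) ⊆ BPPRelClass 𝒞 :=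
  fun _ hL => Set.mem_biUnion hA hL

/-- A collapsing world inside `𝒞` puts `BQP` inside `BPP^𝒞`. [cite: HiraharaLuRen2023, §1.4.2 (p. 11)] -/
theorem BQP_subset_BPPRelClass_of_collapse {𝒞 : Set (Language Bool)} {A : Language Bool}
    (hA : A ∈ 𝒞) (h : BQPRel A ⊆ BPPRel (Oracle.ofLanguage A)) : BQP ⊆ BPPRelClass 𝒞 :=
  (BQP_subset_BPPRel_of_collapse h).trans (BPPRel_subset_BPPRelClass_of_mem hA)

/-- **A `𝒞`-bounded barrier against the summit forces `BQP ⊆ BPP^𝒞`**: e.g. a barrier carried by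
an oracle in `PH` would give `BQP ⊆ BPP^PH` (relativized contrary: Raz–Tal), by an oracle in `BPP`
would give `BQP ⊆ BPP^BPP = BPP` (the negation of the summit), by an oracle in `P/poly` gives
`BQP ⊆ P/poly` (`BQP_subset_PPoly_of_not_cRelativizes_PPoly`). The catalogued collapsing oracles
(`PSPACE`-complete; Ko's self-encoding oracle; the brain cone) lie in none of these classes unless
the corresponding inclusion holds. [cite: HiraharaLuRen2023, §1.1 (p. 3) and §1.4.2 (p. 11)] [cite: FortnowRogers1999JCSS, proof of Thm. 4.2 (p. 7) (arXiv numbering)] -/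
theorem BQP_subset_BPPRelClass_of_not_cRelativizes (𝒞 : Set (Language Bool))
    {C : Oracle → Set (Language Bool)} (hC : PresentsBQPRel C)
    (h : ¬ CRelativizes 𝒞 fun O => ∃ L ∈ C O, L ∉ BPPRel O) : BQP ⊆ BPPRelClass 𝒞 := by
  obtain ⟨A, hA, hcoll⟩ := (not_cRelativizes_summit_shape_iff 𝒞 hC).1 h
  exact BQP_subset_BPPRelClass_of_collapse hA hcoll

/-- Contrapositive: if `BQP ⊄ BPP^𝒞` then the summit's shape holds relative to EVERY oracle of
`𝒞` — arguments robust only under `𝒞`-oracles are not obstructed. [cite: HiraharaLuRen2023, §1.1 (p. 3)] -/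
theorem cRelativizes_summit_shape_of_not_subset {𝒞 : Set (Language Bool)}
    {C : Oracle → Set (Language Bool)} (hC : PresentsBQPRel C) (h : ¬ BQP ⊆ BPPRelClass 𝒞) :
    CRelativizes 𝒞 fun O => ∃ L ∈ C O, L ∉ BPPRel O :=
  not_not.1 fun h' => h (BQP_subset_BPPRelClass_of_not_cRelativizes 𝒞 hC h')

/-! #### Thin oracles: `P/poly`, sparse, tally -/

/-- `BPP^A ⊆ P/poly` for `A ∈ P/poly`: `BPP^A = BP·(P^A) ⊆ BP·(P/poly) = P/poly` (tree theorems: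
`P/poly` is closed under Cook reductions, `PRel_ofLanguage_subset_PPoly` — Meyer's theorem for
sparse `A` — and under `BP·`, `bp_PPoly_subset_PPoly`, Adleman). [cite: AroraBarakCC2009, Thm. 6.18 with Def. 6.5, and Thm. 7.14 (Adleman)] [cite: Schoning1995, §4, Theorem (Karp–Lipton 1980; Berman–Hartmanis 1977) (pp. 528–529)] -/
theorem BPPRel_ofLanguage_subset_PPoly {A : Language Bool} (hA : A ∈ PPoly) :
    BPPRel (Oracle.ofLanguage A) ⊆ PPoly :=
  (bp_mono (PRel_ofLanguage_subset_PPoly hA)).trans bp_PPoly_subset_PPoly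

/-- **A collapsing oracle of polynomial circuit complexity forces `BQP ⊆ P/poly`:**
`BQP ⊆ BQP^A ⊆ BPP^A ⊆ P/poly`. Hence every oracle carrying the no-go against the summit lies
OUTSIDE `P/poly` unless `BQP ⊆ P/poly` (the `BQP` analogue of
`PneNP.NP_subset_PPoly_of_PPoly_collapse`). [cite: Schoning1995, §3 (p. 527) and §4 (pp. 528–529)] [cite: AroraBarakCC2009, Thm. 6.18 and Thm. 7.14] -/
theorem BQP_subset_PPoly_of_PPoly_collapse {A : Language Bool} (hA : A ∈ PPoly)
    (h : BQPRel A ⊆ BPPRel (Oracle.ofLanguage A)) : BQP ⊆ PPoly :=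
  (BQP_subset_BPPRel_of_collapse h).trans (BPPRel_ofLanguage_subset_PPoly hA)

/-- Sparse case (`IsSparseLanguage ⊆ P/poly`, `PneNP.sparseLanguage_subset_PPoly`). [cite: Schoning1995, §3 (p. 527)] [cite: Kadin1989, §1 (p. 286)] -/
theorem BQP_subset_PPoly_of_sparse_collapse {S : Language Bool} (hS : IsSparseLanguage S)
    (h : BQPRel S ⊆ BPPRel (Oracle.ofLanguage S)) : BQP ⊆ PPoly :=
  BQP_subset_PPoly_of_PPoly_collapse (sparseLanguage_subset_PPoly hS) h

/-- Tally case (`IsTally ⊆ P/poly`, `PneNP.tally_subset_PPoly`). [cite: Schoning1995, §3 (p. 527)] -/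
theorem BQP_subset_PPoly_of_tally_collapse {T : Language Bool} (hT : IsTally T)
    (h : BQPRel T ⊆ BPPRel (Oracle.ofLanguage T)) : BQP ⊆ PPoly :=
  BQP_subset_PPoly_of_PPoly_collapse (tally_subset_PPoly hT) h

/-- A `P/poly`-bounded no-go against the summit's shape forces `BQP ⊆ P/poly`. [cite: Schoning1995, §3 (p. 527)] [cite: HiraharaLuRen2023, §1.4.2 (p. 11)] -/
theorem BQP_subset_PPoly_of_not_cRelativizes_PPoly
    {C : Oracle → Set (Language Bool)} (hC : PresentsBQPRel C)
    (h : ¬ CRelativizes PPoly fun O => ∃ L ∈ C O, L ∉ BPPRel O) : BQP ⊆ PPoly := by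
  obtain ⟨A, hA, hcoll⟩ := (not_cRelativizes_summit_shape_iff _ hC).1 h
  exact BQP_subset_PPoly_of_PPoly_collapse hA hcoll

/-- **No thin-oracle barrier against quantum advantage unless `BQP ⊆ P/poly`:** if `BQP ⊄ P/poly`
then `∃ L ∈ BQP^A, L ∉ BPP^A` for EVERY `A ∈ P/poly` — the summit's shape is
`P/poly`-relativizing. Read contrapositively: every proof of `BQP ⊄ P/poly` is automatically
robust under all `P/poly` oracles (Schöning's remark on the sparseness of Baker–Gill–Solovay's
`B`, transposed). [cite: Schoning1995, §3 (p. 527)] [cite: AroraBarakCC2009, Thm. 6.18 and Thm. 7.14] -/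
theorem ppoly_cRelativizes_summit_shape {C : Oracle → Set (Language Bool)} (hC : PresentsBQPRel C)
    (hBQP : ¬ BQP ⊆ PPoly) : CRelativizes PPoly fun O => ∃ L ∈ C O, L ∉ BPPRel O :=
  not_not.1 fun h => hBQP (BQP_subset_PPoly_of_not_cRelativizes_PPoly hC h)

/-- Sparse version of `ppoly_cRelativizes_summit_shape`. [cite: Schoning1995, §3 (p. 527)] -/
theorem sparse_cRelativizes_summit_shape {C : Oracle → Set (Language Bool)} (hC : PresentsBQPRel C)
    (hBQP : ¬ BQP ⊆ PPoly) :
    CRelativizes {S | IsSparseLanguage S} fun O => ∃ L ∈ C O, L ∉ BPPRel O :=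
  (ppoly_cRelativizes_summit_shape hC hBQP).anti sparseLanguage_subset_PPoly

/-- Tally version of `ppoly_cRelativizes_summit_shape`. [cite: Schoning1995, §3 (p. 527)] -/
theorem tally_cRelativizes_summit_shape {C : Oracle → Set (Language Bool)} (hC : PresentsBQPRel C)
    (hBQP : ¬ BQP ⊆ PPoly) :
    CRelativizes {T | IsTally T} fun O => ∃ L ∈ C O, L ∉ BPPRel O :=
  (ppoly_cRelativizes_summit_shape hC hBQP).anti tally_subset_PPoly

/-! #### The negation side over thin oracles -/

/-- **A tally no-go against `BQP ⊆ BPP` is at least the summit:** if `∃ L ∈ BQP, L ∉ BPP` then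
the tally world `∅` separates, so `O ↦ BQP^O ⊆ BPP^O` is not tally-relativizing (canonical
presentation; tree facts `PRel_empty`, `BQPRel_zero`). The converse "tally ⟹ empty" is Long–Selman's
positive relativization for the SYNTACTIC pair `P`/`NP` (`PneNP.longSelman1986_tally`); for
promise classes such as bounded-error probabilistic ones it fails in relativized worlds
(Hemachandra–Rubinstein, Thm. 2.1: `P^C = R^C` yet `P^{C ⊕ T} ≠ R^{C ⊕ T}` for a tally `T`), and
`BQP`, `BPP` are promise classes in that sense. [cite: HemachandraRubinstein1992, Thm. 2.1 (p. 312) and Lemma 2.3 (p. 313)] [cite: LongSelman1986, abstract] -/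
theorem not_cRelativizes_tally_collapse_shape_of_summit (hE : PRel_empty) (hZ : BQPRel_zero)
    (h : ∃ L : Language Bool, L ∈ BQP ∧ L ∉ BPP) :
    ¬ CRelativizes {T | IsTally T} fun O => bqpRelOf O ⊆ BPPRel O := by
  refine not_cRelativizes_of_counterexample 0 isTally_zero fun hsub => ?_
  obtain ⟨L, hL, hLB⟩ := h
  have hsub' : bqpRelOf Oracle.empty ⊆ BPPRel Oracle.empty := hsub
  rw [collapse_shape_empty_iff hE hZ] at hsub'
  exact hLB (hsub' hL)

/-- **The Fortnow–Rogers brain cone collapses** (tree theorem `FRBrain.exists_brain`, the second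
half of the proof of Fortnow–Rogers' Thm. 4.2 by the BBBV hybrid bound and a heavy-query
fixed-point loop): there is `K` with `BQP^{K ⊕ G} ⊆ P^{K ⊕ G} ⊆ BPP^{K ⊕ G}` for EVERY `G` with at
most one string of each length — continuum many collapsing worlds, of every Turing degree above
`K`, and no thin `G` creates quantum advantage over the brain. [cite: FortnowRogers1999JCSS, Thm. 4.2 and its proof (p. 7) and Thm. 4.3 (arXiv numbering)] [cite: BennettBernsteinBrassardVazirani1997, Thm. 3.3 and Cor. 3.4] -/
theorem exists_brain_collapse :
    ∃ K : Language Bool, ∀ G : Language Bool,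
      (∀ ℓ, {z : List Bool | z ∈ G ∧ z.length = ℓ}.Subsingleton) →
        BQPRel (BrainProtocol.joinLang K G) ⊆ BPPRel (Oracle.ofLanguage (BrainProtocol.joinLang K G)) := by
  obtain ⟨K, hK⟩ := FRBrain.exists_brain
  exact ⟨K, fun G hG => (hK G hG).trans (PRel_subset_BPPRel_holds _)⟩

/-- **The brain cone as an oracle class**: over `{K ⊕ G : G thin}` the negation's shape
`BQP^O ⊆ BPP^O` IS relativizing (no separating world in the cone) and the summit's shape is not
(every world of the cone collapses), for every presentation of `BQP^·`.
[cite: FortnowRogers1999JCSS, Thm. 4.2 and its proof (p. 7) (arXiv numbering)] -/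
theorem exists_brain_cone {C : Oracle → Set (Language Bool)} (hC : PresentsBQPRel C) :
    ∃ K : Language Bool,
      (CRelativizes {A | ∃ G : Language Bool,
          (∀ ℓ, {z : List Bool | z ∈ G ∧ z.length = ℓ}.Subsingleton) ∧ A = BrainProtocol.joinLang K G}
        fun O => C O ⊆ BPPRel O) ∧
      ¬ CRelativizes {A | ∃ G : Language Bool,
          (∀ ℓ, {z : List Bool | z ∈ G ∧ z.length = ℓ}.Subsingleton) ∧ A = BrainProtocol.joinLang K G}
        fun O => ∃ L ∈ C O, L ∉ BPPRel O := by
  obtain ⟨K, hK⟩ := exists_brain_collapse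
  refine ⟨K, ?_, ?_⟩
  · rintro A ⟨G, hG, rfl⟩
    show C (Oracle.ofLanguage (BrainProtocol.joinLang K G)) ⊆ _
    rw [hC]
    exact hK G hG
  · refine not_cRelativizes_of_counterexample (BrainProtocol.joinLang K (0 : Language Bool)) ⟨0, fun ℓ => ?_, rfl⟩ ?_
    · intro z hz
      exact (Language.notMem_zero z hz.1).elim
    · rintro ⟨L, hL, hLB⟩
      rw [hC] at hL
      exact hLB (hK 0 (fun ℓ z hz => (Language.notMem_zero z hz.1).elim) hL)

/-! #### The narrowed barrier -/

/-- **Relativization barrier for `BQP` versus `BPP`, narrowed form (audit 2026-08-16).**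
Bernstein–Vazirani / Baker–Gill–Solovay with the carrier datum of each direction: (1) a whole
CONE of collapsing worlds — a brain oracle `K` with `BQP^{K ⊕ G} ⊆ P^{K ⊕ G}` for every `G` with
at most one string per length (Fortnow–Rogers' proof of Thm. 4.2; tree theorem
`FRBrain.exists_brain`; `G = ∅` gives the plain collapsing oracle); (2) every collapsing world of
polynomial circuit complexity forces `BQP ⊆ P/poly` (tree theorem
`BQP_subset_PPoly_of_PPoly_collapse`: the collapse side is carried by oracles outside `P/poly`);
(3) a separating world `BQP^B ⊄ BPP^B` (Bernstein–Vazirani Thm. 8.10 / Cor. 8.14; in the tree the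
Raz–Tal Forrelation oracle). PROVED here outright (`BQPRelativizationNarrow_holds`, from `BQPRelativizationNarrow.of_facts` and the
discharged separating-oracle fact `exists_oracle_BQPRel_not_subset_BPPRel_holds`), and equivalent
to `Relativization` over the tree theorems (`bqpRelativizationNarrow_iff`).

BARRIER
technique_class: relativizing (over ALL language oracles, dense and `PSPACE`-hard ones included, in the full-access models `BQPRel` / `BPPRel`), oracle-independent (same sense); `𝒞`-relativizing for a class `𝒞` exactly when `𝒞` contains a collapsing world (summit side) or a separating world (negation side); diagonalization / simulation / black-box arguments ONLY insofar as they relativize in this sense — classical simulations of explicit gate sets only if they extend to black-box XOR-query gates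
blocks: (i) every proof of the summit `QuantumAdvantage` (`∃ L ∈ BQP, L ∉ BPP`) that would establish `∃ L ∈ BQP^A, L ∉ BPP^A` for every language oracle `A` INCLUDING the collapsing ones in hand — Ko's self-encoding oracle, the brain cone `{K ⊕ G}` (`exists_brain_cone`), every `PSPACE`-complete oracle (printed) — `Relativization.not_relativizes_summit_shape`; NOT blocked: arguments robust only under the oracles of a class `𝒞` with `BQP ⊄ BPP^𝒞` (`cRelativizes_summit_shape_of_not_subset`, `BQP_subset_BPPRelClass_of_not_cRelativizes`) — only under `P/poly` / sparse / tally oracles unless `BQP ⊆ P/poly` (`ppoly_cRelativizes_summit_shape`, `sparse_cRelativizes_summit_shape`, `tally_cRelativizes_summit_shape`, `BQP_subset_PPoly_of_PPoly_collapse`), only under `PH`-oracles unless `BQP ⊆ BPP^PH`, only under `BPP`-oracles unless `BQP ⊆ BPP^BPP`; contrapositively every proof of `BQP ⊄ P/poly` (route `CircuitLB`) is `P/poly`-oracle-robust for free and meets the barriers against non-uniform lower bounds instead (`Literature.Barriers.QuantumAdvantage.NaturalProofs`); (ii) every proof of `BQP ⊆ BPP` (route `Dequantize`'s thesis and its siblings)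 that would establish `BQP^B ⊆ BPP^B` for every language oracle, the DENSE structured ones (Bernstein–Vazirani, Simon, Raz–Tal Forrelation) included — `Relativization.not_relativizes_collapse_shape`; NOT blocked by any oracle in the tree or in print: arguments robust only under thin oracles — a tally separating oracle is the summit itself (`not_cRelativizes_tally_collapse_shape_of_summit`), the brain cone carries no separating world (`exists_brain_cone`), and no sparse separating oracle for `BQP` versus `BPP` is known (contrast `Literature.Barriers.PneNP.bgs_ne_sparse`: Baker–Gill–Solovay's `B` for `P ≠ NP` IS sparse).
because: `BQP ⊆ BQP^A` for every `A` (tree theorem `BQP_subset_BQPRel`), so a collapsing `A ∈ 𝒞` gives `BQP ⊆ BPP^A ⊆ BPP^𝒞`, and for `A ∈ P/poly`, `BPP^A = BP·(P^A) ⊆ BP·(P/poly) = P/poly` (Meyer: `P^S ⊆ P/poly` for sparse `S`, here `P/poly`'s closure under Cook reductions, tree theorem `PRel_ofLanguage_subset_PPoly` [cite: Schoning1995, §4, Theorem (Karp–Lipton 1980; Berman–Hartmanis 1977) (pp. 528–529)] [cite: Kadin1989, §1 (p. 286)]; Adleman: `BP·(P/poly) = P/poly`, tree theorem `bp_PPoly_subset_PPoly`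 [cite: AroraBarakCC2009, Thm. 7.14 and Thm. 6.18]); the collapse at a `PSPACE`-complete oracle [cite: FortnowRogers1999JCSS, Thm. 4.2 (proof, p. 7: "H can be any PSPACE-complete language") (arXiv numbering)] [cite: AaronsonIngramKretschmer2022, §1.2 (p. 5)] [cite: BernsteinVazirani1997SICOMP, Thm. 8.4 and Thm. 8.6]; the brain cone: only `4T²/ε²` strings are `ε`-sensitive for a `T`-query bounded-error quantum machine [cite: BennettBernsteinBrassardVazirani1997, Thm. 3.3 and Cor. 3.4] [cite: FortnowRogers1999JCSS, Thm. 4.3 (arXiv numbering)], so a deterministic machine with access to a `BQP`-simulating brain finds the sensitive strings, probes the thin part there and re-simulates until no unprobed sensitive string is left [cite: FortnowRogers1999JCSS, Thm. 4.2 (proof, p. 7: "It asks for an explicit enumeration of S … It then queries G for each of those strings") (arXiv numbering)] (tree theorem `FRBrain.BQPRel_joinLang_oracleK_subset_PRel`); the separating oracle [cite: BernsteinVazirani1997SICOMP, Thm. 8.10 and Cor. 8.14] (tree: Raz–Tal, `exists_oracle_BQPRel_not_subset_BPPRel_holds`); the tally separating world `∅` under the summit through `P^∅ = P`, `BQP^∅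 = BQP` (`collapse_shape_empty_iff`).
evasions_known: as for `Relativization` (non-relativizing but algebrizing techniques are ALSO insufficient, `Literature.Barriers.QuantumAdvantage.Algebrization`; conditional separations untouched); in addition: (a) RESTRICTED relativization on the summit side — thin-oracle-robust (`P/poly`, sparse, tally) arguments, blocked iff some thin oracle collapses, which forces `BQP ⊆ P/poly` (above); `PH`-robust arguments, blocked only if `BQP ⊆ BPP^PH` [cite: HiraharaLuRen2023, §1.1 (p. 3) and §1.4.2 (p. 11)]; (b) on the negation side, thin-oracle-robust classical simulations: a simulation of `BQP` that survives sparse XOR-query gates is obstructed by no known oracle; by the brain loop run with a `PromiseBPP` simulator as the brain, `PromiseBQP ⊆ PromiseBPP` would even give `BQP^S ⊆ BPP^S` for every sparse `S` (prose, this audit; ingredients [cite: BennettBernsteinBrassardVazirani1997, Thm. 3.3 and Cor. 3.4] [cite: FortnowRogers1999JCSS, Thm. 4.2 (proof, p. 7) (arXiv numbering)]), so a sparse no-go against `Dequantize` would itself separate `PromiseBQP` from `PromiseBPP`; (c) the PROMISE SEAM: `BQP`, `BPP` are promise classes, for which "tally sets are more likely than the empty set to separate" — Long–Selman's `P = NP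 ↔ ∀ tally T, P^T = NP^T` [cite: HemachandraRubinstein1992, Lemma 2.3 (p. 313)] [cite: LongSelman1986, abstract] fails in relativized worlds for `UP`, `NP ∩ coNP`, `R` [cite: HemachandraRubinstein1992, Thm. 2.1 (p. 312) and §3 (p. 316)]; the thin-oracle statements of (a)–(b) become provable exactly for the promise versions (`PromiseBQP ⊆ PromiseP/poly ⟹ ∃ tally T, BQP^T ⊆ P^T` by table reading; `PromiseBQP ⊆ PromiseBPP ⟹ ∀ sparse S, BQP^S ⊆ BPP^S`), while their language-level forms are instances of the open promise lift `BQP ⊆ BPP ⟹ PromiseBQP ⊆ PromiseBPP'`, which does not relativize (`Literature.Barriers.QuantumAdvantage.PromiseLiftRelativization`) [cite: Goldreich2011, §6] [cite: AaronsonArkhipovToC2013, §10, items (9)–(10) (p. 236)]; (d) "relativizing" versus "black-box" are different axes — a non-relativizing technique may still be black-box [cite: Aaronson2006, §1.2–§1.3 (pp. 5–6) (arXiv numbering)]; white-box classical simulations of explicit gate sets (stabilizer normal forms [cite: Gottesman1998, Thm. 1 (p. 13) (arXiv numbering)], and the tree's own dequantization entries A10–A12, A16 of `Catalogue.lean`)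 do not extend to black-box XOR-query gates and are outside the class, whereas entrywise simulations (Feynman path sums, Schrödinger vectors) relativize — they prove `BQP^O ⊆ P^{#P^O} ⊆ PSPACE^O` [cite: BernsteinVazirani1997SICOMP, Thm. 8.4 and Thm. 8.6] — and are blocked.
scope_caveats: (a) "technique robust under `𝒞`-oracles" is informal exactly as "relativizing technique" in `Relativization`; the precise content is `CRelativizes 𝒞 Φ` / `¬ CRelativizes 𝒞 Φ` for the listed `𝒞`, `Φ` [cite: HiraharaLuRen2023, §1.1 (p. 3)] [cite: AroraBarakCC2009, §3.4.1 pp. 75–76]; (b) conjuncts (1)–(2) are tree theorems and (3) is the discharged separating fact, so the fact is equivalent to `Relativization` (`bqpRelativizationNarrow_iff`) — the narrowing is in the recorded carrier data and in this block, not in logical strength beyond (1); (c) NOT recorded formally: the collapse at `PSPACE`-complete oracles (needs relativized `BQP ⊆ PSPACE` and `PSPACE^A = P^A` for `BQPRel`; cf. `Literature.Barriers.PneNP.BoundedRelativization` for `P` versus `NP`), `BPP^BPP = BPP`, `BPP^PH ⊆ PH`, and the promise-class statements of evasions_known (b)–(c) — prose; in particular the CONVERSE of (2) ("`BQP ⊆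 P/poly` ⟹ some thin oracle collapses") is not claimed: for the syntactic pair `P`/`NP` it holds (`Literature.Barriers.PneNP.RelativizationSparseNarrow`), for `BQP` only its promise version is apparent; (d) thin classes: `IsTally ⊆ IsSparseLanguage ⊆ PPoly` (tree); the brain cone's thin part has census `≤ 1` per length (`Set.Subsingleton` slices) and sits in the `1·` half of the join `BrainProtocol.joinLang`; (e) as in `Relativization` (b), (e): language classes with XOR-query gates to LANGUAGE oracles only; promise / sampling / advice / average-case strengthenings are the entries A06–A09.
status: theorem (established; proved in this file: `BQPRelativizationNarrow_holds`, axioms `propext`, `Classical.choice`, `Quot.sound`) [cite: FortnowRogers1999JCSS, Thm. 4.2 and Thm. 4.3 (arXiv numbering)] [cite: BernsteinVazirani1997SICOMP, Thm. 8.10, Cor. 8.14, Thm. 8.4] [cite: Schoning1995, §3–§4 (pp. 525–529)] -/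
def BQPRelativizationNarrow : Prop :=
  (∃ K : Language Bool, ∀ G : Language Bool,
      (∀ ℓ, {z : List Bool | z ∈ G ∧ z.length = ℓ}.Subsingleton) →
        BQPRel (BrainProtocol.joinLang K G) ⊆ PRel (Oracle.ofLanguage (BrainProtocol.joinLang K G))) ∧
    (∀ A ∈ PPoly, BQPRel A ⊆ BPPRel (Oracle.ofLanguage A) → BQP ⊆ PPoly) ∧
      ∃ B : Language Bool, ¬ BQPRel B ⊆ BPPRel (Oracle.ofLanguage B)

/-- `BQPRelativizationNarrow` from the separating-oracle fact of `OracleSeparations.lean`;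
conjuncts (1)–(2) are the tree theorems `FRBrain.exists_brain` and
`BQP_subset_PPoly_of_PPoly_collapse`. [cite: FortnowRogers1999JCSS, Thm. 4.2 (arXiv numbering)] [cite: BernsteinVazirani1997SICOMP, Thm. 8.10 and Cor. 8.14] -/
theorem BQPRelativizationNarrow.of_facts (h₂ : exists_oracle_BQPRel_not_subset_BPPRel) :
    BQPRelativizationNarrow :=
  ⟨FRBrain.exists_brain, fun _ hA h => BQP_subset_PPoly_of_PPoly_collapse hA h, h₂⟩

/-- `BQPRelativizationNarrow` from the catalogued form (only its separating half is used).
[cite: BernsteinVazirani1997SICOMP, Thm. 8.10 and Cor. 8.14] -/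
theorem BQPRelativizationNarrow.of_relativization (h : Relativization) : BQPRelativizationNarrow :=
  BQPRelativizationNarrow.of_facts (let ⟨_, B, _, hB⟩ := h; ⟨B, hB⟩)

/-- The apex of the cone (`G = ∅`) is a collapsing oracle with `BQP^A ⊆ P^A`.
[cite: FortnowRogers1999JCSS, Thm. 4.2 (arXiv numbering)] -/
theorem BQPRelativizationNarrow.exists_collapse_PRel (h : BQPRelativizationNarrow) :
    ∃ A : Language Bool, BQPRel A ⊆ PRel (Oracle.ofLanguage A) := by
  obtain ⟨⟨K, hK⟩, -, -⟩ := h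
  exact ⟨BrainProtocol.joinLang K (0 : Language Bool), hK 0 fun ℓ z hz => (Language.notMem_zero z hz.1).elim⟩

/-- The narrowed form implies the catalogued form `Relativization` (through the tree theorem
`P^O ⊆ BPP^O`, `PRel_subset_BPPRel_holds`). [cite: BernsteinVazirani1997SICOMP, §8.4 with Thm. 8.4 and Cor. 8.14] -/
theorem BQPRelativizationNarrow.relativization (h : BQPRelativizationNarrow) : Relativization := by
  obtain ⟨A, hA⟩ := h.exists_collapse_PRel
  obtain ⟨-, -, B, hB⟩ := h
  exact ⟨A, B, hA.trans (PRel_subset_BPPRel_holds _), hB⟩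

/-- Over the tree theorems the narrowed and the catalogued forms are equivalent: the narrowing is
in the recorded carrier data, not in logical strength. [folklore] -/
theorem bqpRelativizationNarrow_iff : BQPRelativizationNarrow ↔ Relativization :=
  ⟨BQPRelativizationNarrow.relativization, BQPRelativizationNarrow.of_relativization⟩

/-- **Summary of the narrowed barrier.** (1) the summit's shape does not relativize; (2) nor
does its negation's; (3) a `𝒞`-bounded no-go against the summit forces `BQP ⊆ BPP^𝒞`; (4) unless
`BQP ⊆ P/poly` the summit's shape is `P/poly`-relativizing; (5) the brain cone collapses, for
every presentation of `BQP^·`. [cite: FortnowRogers1999JCSS, Thm. 4.2 (arXiv numbering)] [cite: HiraharaLuRen2023, §1.1 (p. 3)] [cite: Schoning1995, §3 (p. 527)] -/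
theorem BQPRelativizationNarrow.summary (h : BQPRelativizationNarrow)
    {C : Oracle → Set (Language Bool)} (hC : PresentsBQPRel C) :
    (¬ Relativizes fun O => ∃ L ∈ C O, L ∉ BPPRel O) ∧
      (¬ Relativizes fun O => C O ⊆ BPPRel O) ∧
        (∀ 𝒞 : Set (Language Bool),
          (¬ CRelativizes 𝒞 fun O => ∃ L ∈ C O, L ∉ BPPRel O) → BQP ⊆ BPPRelClass 𝒞) ∧
          (¬ BQP ⊆ PPoly → CRelativizes PPoly fun O => ∃ L ∈ C O, L ∉ BPPRel O) ∧
            ∃ K : Language Bool, ∀ G : Language Bool,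
              (∀ ℓ, {z : List Bool | z ∈ G ∧ z.length = ℓ}.Subsingleton) →
                C (Oracle.ofLanguage (BrainProtocol.joinLang K G)) ⊆
                  BPPRel (Oracle.ofLanguage (BrainProtocol.joinLang K G)) := by
  refine ⟨h.relativization.not_relativizes_summit_shape hC,
    h.relativization.not_relativizes_collapse_shape hC,
    fun 𝒞 h𝒞 => BQP_subset_BPPRelClass_of_not_cRelativizes 𝒞 hC h𝒞,
    ppoly_cRelativizes_summit_shape hC, ?_⟩
  obtain ⟨⟨K, hK⟩, -, -⟩ := h
  exact ⟨K, fun G hG => by rw [hC]; exact (hK G hG).trans (PRel_subset_BPPRel_holds _)⟩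

/-! #### Unconditional forms -/

/-- **`BQPRelativizationNarrow` holds**: the brain cone of collapsing worlds, the `P/poly` clause and a
separating world, the separating-oracle fact being discharged in the tree
(`exists_oracle_BQPRel_not_subset_BPPRel_holds`, Raz–Tal). [cite: FortnowRogers1999JCSS, Thm. 4.2 and Thm. 4.3 (arXiv numbering)] [cite: BernsteinVazirani1997SICOMP, Thm. 8.10 and Cor. 8.14] [cite: RazTalJACM2022, Cor. 1.5 (App. A)] -/
theorem BQPRelativizationNarrow_holds : BQPRelativizationNarrow :=
  BQPRelativizationNarrow.of_facts exists_oracle_BQPRel_not_subset_BPPRel_holds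

/-- Hypothesis-free form of `BQPRelativizationNarrow.summary`, for every presentation of `BQP^·`.
[cite: FortnowRogers1999JCSS, Thm. 4.2 (arXiv numbering)] [cite: HiraharaLuRen2023, §1.1 (p. 3)] [cite: Schoning1995, §3 (p. 527)] -/
theorem BQPRelativizationNarrow.summary' {C : Oracle → Set (Language Bool)} (hC : PresentsBQPRel C) :
    (¬ Relativizes fun O => ∃ L ∈ C O, L ∉ BPPRel O) ∧
      (¬ Relativizes fun O => C O ⊆ BPPRel O) ∧
        (∀ 𝒞 : Set (Language Bool),
          (¬ CRelativizes 𝒞 fun O => ∃ L ∈ C O, L ∉ BPPRel O) → BQP ⊆ BPPRelClass 𝒞) ∧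
          (¬ BQP ⊆ PPoly → CRelativizes PPoly fun O => ∃ L ∈ C O, L ∉ BPPRel O) ∧
            ∃ K : Language Bool, ∀ G : Language Bool,
              (∀ ℓ, {z : List Bool | z ∈ G ∧ z.length = ℓ}.Subsingleton) →
                C (Oracle.ofLanguage (BrainProtocol.joinLang K G)) ⊆
                  BPPRel (Oracle.ofLanguage (BrainProtocol.joinLang K G)) :=
  BQPRelativizationNarrow_holds.summary hC

/-- Over the single world `∅` the summit's shape IS the summit, hypothesis-free
(`PRel_empty_holds`, `BQPRel_zero_holds`). [cite: HiraharaLuRen2023, §1.1 (p. 3)] -/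
theorem cRelativizes_singleton_zero_summit_shape_iff' :
    (CRelativizes {(0 : Language Bool)} fun O => ∃ L ∈ bqpRelOf O, L ∉ BPPRel O) ↔
      ∃ L : Language Bool, L ∈ BQP ∧ L ∉ BPP :=
  cRelativizes_singleton_zero_summit_shape_iff PRel_empty_holds BQPRel_zero_holds

/-- A tally no-go against `BQP ⊆ BPP` is at least the summit, hypothesis-free: the summit makes the
tally world `∅` separating. [cite: HemachandraRubinstein1992, Thm. 2.1 (p. 312) and Lemma 2.3 (p. 313)] -/
theorem not_cRelativizes_tally_collapse_shape_of_summit'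
    (h : ∃ L : Language Bool, L ∈ BQP ∧ L ∉ BPP) :
    ¬ CRelativizes {T | IsTally T} fun O => bqpRelOf O ⊆ BPPRel O :=
  not_cRelativizes_tally_collapse_shape_of_summit PRel_empty_holds BQPRel_zero_holds h

end Literature.Barriers.QuantumAdvantage

end
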